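import Mathlib.Algebra.Module.Submodule.Basic
import Mathlib.LinearAlgebra.BilinearMap
import Mathlib.Algebra.NoZeroSMulDivisors.Basic
import Mathlib.Tactic.Ring
import HarnessLib

/-!
# Route `RamifiedHeegnerPair`, crux U₁ `LeafRankOneUpperAtThree` (stmt-BirchSwinnertonDyer-26022), line `partnerdescent` —
# partner kernel: DICTIONARY ARITHMETIC — the hypotheses `hP`, `hlat` of the local run from Takahashi's dictionary data (`π^*1 = ±j·g`, adjunction, `δ·i = ξ·j`)

HONEST FRAMING. Theorems only; helper file (`--supports stmt-BirchSwinnertonDyer-26022 --as helper`); elementary module arithmetic over a domain; no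
number theory, no named fact, no `sorry`; nothing booked; BSD is proved for no curve. Lead prover bsd-line-rhp-p2 g63, 2026-08-31. Serves layer (α)
of LEAD-G63-ASSEMBLY.md §4b–§4c.

WHY. The local run `LeafPartnerOrders.dvd_of_localRun` (p811638) takes the eigen-element `t = N·e_f` (`ξ·t(x) = N·⟨g, x⟩·g`), the map
`P(y) = π_*(y)·π^*(1)` and the relations `hP : δ·t(y) = N·P(y)` and `hlat : (R·t)(y) = N·y′` with `y′ ∈ Y` (`R = ξ/i`). In the dictionary
(`hDictDisc` of `…BrandtDictionaryProofs`: `⟨π^*a, y⟩ = c·a·π_*(y)`, `π^*1` in the rank-one eigen-line `ℤg`, so `π^*1 = ε·j·g` with `ε = ±1`, and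
Takahashi's `i·j = c`, `δ·i = ξ·j`) these are IDENTITIES: `⟨g, y⟩ = ε·i·π_*(y)` (`pairing_eq_of_adjunction`), hence `δ·t(y) = N·P(y)`
(`degree_smul_eq_of_dictionary`) and `R·t(y) = N·(ε·π_*(y)·g)` (`denominator_smul_eq_of_dictionary`) — with `g ∈ Y` the element `ε·π_*(y)·g`
lies in `Y`. Stated over any commutative domain `R₀` acting on a torsion-free module (in the derivation `ℤ_[3]` on `B̂`, after base change of the
integral identities, or `ℤ` on `B` before it). [cite: Takahashi2001, Lemma 2.2, Thm. 2.3 (p. 79), Thm. 3.2 (a) (p. 82)]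
[cite: PapikianRabinoff2016, §3 ¶23–¶25]
-/

set_option linter.dupNamespace false
set_option autoImplicit false

namespace Summit.BirchSwinnertonDyer.BirchSwinnertonDyer.Theorems.LeafPartnerOrders

variable {R₀ : Type*} [CommRing R₀] [IsDomain R₀] {M : Type*} [AddCommGroup M] [Module R₀ M] [NoZeroSMulDivisors R₀ M]

omit [NoZeroSMulDivisors R₀ M] in
/-- **`⟨g, y⟩ = ε·i·π_*(y)`.** From the adjunction at `a = 1` (`⟨π^*1, y⟩ = c·π_*(y)`), `π^*1 = (ε·j)·g` with `ε² = 1`, and `i·j = c`, `j ≠ 0`.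
[cite: Takahashi2001, Lemma 2.2 and Thm. 3.2 (a)] -/
theorem pairing_eq_of_adjunction (β : M →ₗ[R₀] M →ₗ[R₀] R₀) {g pb1 : M} {pf : M → R₀} {c i j ε : R₀}
    (hadj : ∀ y : M, β pb1 y = c * pf y) (hpb : pb1 = (ε * j) • g) (hij : i * j = c) (hj : j ≠ 0) (hε : ε * ε = 1)
    (y : M) : β g y = ε * i * pf y := by
  have h1 : ε * j * β g y = i * j * pf y := by
    have := hadj y
    rw [hpb, map_smul, LinearMap.smul_apply, smul_eq_mul, ← hij] at this
    exact this
  -- cancel `j`, then multiply by `ε`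
  have h2 : j * (ε * β g y - i * pf y) = 0 := by
    have : j * (ε * β g y) = j * (i * pf y) := by
      rw [← mul_assoc, mul_comm j ε, h1]; ring
    rw [mul_sub, this, sub_self]
  have h3 : ε * β g y = i * pf y := sub_eq_zero.mp ((mul_eq_zero.mp h2).resolve_left hj)
  calc β g y = ε * ε * β g y := by rw [hε, one_mul]
    _ = ε * (ε * β g y) := by ring
    _ = ε * (i * pf y) := by rw [h3]
    _ = ε * i * pf y := by ring

/-- **`δ·t(y) = N·P(y)`** (hypothesis `hP` of `dvd_of_localRun`): with `ξ·t(x) = N·⟨g, x⟩·g` (`t = N·e_f`), `P(y) = π_*(y)·π^*(1)`,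
`⟨g, y⟩ = ε·i·π_*(y)`, `π^*1 = ε·j·g` and Takahashi's `δ·i = ξ·j`, `ξ ≠ 0`; the module is torsion-free, so `ξ` cancels.
[cite: Takahashi2001, Thm. 2.3] [cite: PapikianRabinoff2016, §3 ¶25] -/
theorem degree_smul_eq_of_dictionary (β : M →ₗ[R₀] M →ₗ[R₀] R₀) {g pb1 : M} {pf : M → R₀} {c i j ε ξ δ N : R₀}
    (hadj : ∀ y : M, β pb1 y = c * pf y) (hpb : pb1 = (ε * j) • g) (hij : i * j = c) (hj : j ≠ 0) (hε : ε * ε = 1)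
    (hδ : δ * i = ξ * j) (hξ : ξ ≠ 0) {t : M → M} (ht : ∀ x : M, ξ • t x = N • β g x • g) (y : M) :
    δ • t y = N • pf y • pb1 := by
  have hgy := pairing_eq_of_adjunction β hadj hpb hij hj hε y
  apply smul_right_injective M hξ
  change ξ • (δ • t y) = ξ • (N • pf y • pb1)
  rw [smul_comm ξ δ, ht, hgy, hpb]
  simp only [smul_smul]
  congr 1
  -- `δ (N (ε i pf y)) = ξ (N (pf y (ε j)))`, by `δ i = ξ j`
  calc δ * (N * (ε * i * pf y)) = (δ * i) * (N * ε * pf y) := by ring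
    _ = (ξ * j) * (N * ε * pf y) := by rw [hδ]
    _ = ξ * (N * (pf y * (ε * j))) := by ring

/-- **`R·t(y) = N·(ε·π_*(y)·g)`** with `R·i = ξ` (hypothesis `hlat` of `dvd_of_localRun`: for `y ∈ Y` the vector `ε·π_*(y)·g` lies in `Y`
because `g ∈ Y`). [cite: Takahashi2001, Thm. 2.3] [cite: PapikianRabinoff2016, Thm. 30 (4)⟺(7)] -/
theorem denominator_smul_eq_of_dictionary (β : M →ₗ[R₀] M →ₗ[R₀] R₀) {g pb1 : M} {pf : M → R₀} {c i j ε ξ Rl N : R₀}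
    (hadj : ∀ y : M, β pb1 y = c * pf y) (hpb : pb1 = (ε * j) • g) (hij : i * j = c) (hj : j ≠ 0) (hε : ε * ε = 1)
    (hRl : Rl * i = ξ) (hξ : ξ ≠ 0) {t : M → M} (ht : ∀ x : M, ξ • t x = N • β g x • g) (y : M) :
    Rl • t y = N • (ε * pf y) • g := by
  have hgy := pairing_eq_of_adjunction β hadj hpb hij hj hε y
  apply smul_right_injective M hξ
  change ξ • (Rl • t y) = ξ • (N • (ε * pf y) • g)
  rw [smul_comm ξ Rl, ht, hgy]
  simp only [smul_smul]
  congr 1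
  calc Rl * (N * (ε * i * pf y)) = (Rl * i) * (N * (ε * pf y)) := by ring
    _ = ξ * (N * (ε * pf y)) := by rw [hRl]

end Summit.BirchSwinnertonDyer.BirchSwinnertonDyer.Theorems.LeafPartnerOrders
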